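import Mathlib.Probability.Martingale.OptionalStopping
import Mathlib.MeasureTheory.Function.ConditionalExpectation.PullOut
import HarnessLib

/-!
# Doob's `L²` maximal inequality for continuous-time martingales with continuous paths

Mathlib (pinned commit) has Doob's maximal inequality `MeasureTheory.maximal_ineq` for
nonnegative *discrete-time* submartingales. This file derives the form needed by the
Itô-integral layer of `Literature` (u.c.p. estimates for elementary stochastic integrals):

* `MeasureTheory.Martingale.submartingale_sq` — the square of a square-integrable martingale is a
  submartingale (any index set; direct computation, no conditional Jensen needed);
* `MeasureTheory.Martingale.reindex_nat` — a martingale read along a monotone sequence of times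
  is a discrete-time martingale for the correspondingly read filtration (the reindexed
  filtration is built inline by the anonymous constructor; no new definition);
* `Literature.Probability.Process.doob_sq_maximal_ineq_grid` — discrete Doob along a finite grid of times:
  `ε² · μ {∃ k ≤ N, ε ≤ |M_{τ k}|} ≤ E[M_{τ N}²]`;
* `Literature.Probability.Process.doob_sq_maximal_ineq_of_continuous` — **continuous time**: for a square-integrable
  martingale `M` indexed by `ℝ≥0` with a.s. continuous paths, `ε > 0` and `t`,
  `μ {ω | ∃ s ≤ t, ε ≤ |M s ω|} ≤ E[M_t²] / ε²` (dyadic grids + path continuity).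

## References

* D. Revuz, M. Yor, *Continuous Martingales and Brownian Motion* (3rd ed., 1999), Ch. II,
  Thm (1.7) (Doob's `Lᵖ`/maximal inequality, continuous time via countable dense sets).
* J. L. Doob, *Stochastic Processes* (1953), Ch. VII, Thm 3.2.
-/

open MeasureTheory ProbabilityTheory Filter Finset
open scoped NNReal ENNReal Topology

namespace MeasureTheory

variable {Ω ι : Type*} [Preorder ι] {m : MeasurableSpace Ω} {μ : Measure Ω} {𝓕 : Filtration ι m}
  {M : ι → Ω → ℝ}

/-- **The square of a square-integrable martingale is a submartingale**:
`E[M_j² | 𝓕 i] = M_i² + E[(M_j - M_i)² | 𝓕 i] ≥ M_i²` for `i ≤ j`. Dot-notation extension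
declared in Mathlib's namespace `MeasureTheory.Martingale`.
Revuz–Yor, *Continuous Martingales and Brownian Motion* (1999), Ch. II, §1, remark after
Prop. (1.2) ("if `X_t` is a martingale … `|X_t|^p` is a submartingale"). [folklore] -/
theorem Martingale.submartingale_sq [IsFiniteMeasure μ] (hM : Martingale M 𝓕 μ)
    (hL2 : ∀ i, MemLp (M i) 2 μ) : Submartingale (fun i ω ↦ M i ω ^ 2) 𝓕 μ := by
  refine ⟨fun i ↦ (hM.stronglyAdapted i).pow 2, fun i j hij ↦ ?_, fun i ↦ (hL2 i).integrable_sq⟩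
  -- `M_j² = M_i² + 2 M_i D + D²` with `D = M_j - M_i`
  set D : Ω → ℝ := M j - M i with hD
  have hMi2 : Integrable (fun ω ↦ M i ω ^ 2) μ := (hL2 i).integrable_sq
  have hDL2 : MemLp D 2 μ := (hL2 j).sub (hL2 i)
  have hMiD : Integrable (M i * D) μ := (hL2 i).integrable_mul hDL2
  have hD2 : Integrable (fun ω ↦ D ω ^ 2) μ := hDL2.integrable_sq
  have hDint : Integrable D μ := (hM.integrable j).sub (hM.integrable i)
  have hdec : (fun ω ↦ M j ω ^ 2) =
      (fun ω ↦ M i ω ^ 2) + (2 : ℝ) • (M i * D) + fun ω ↦ D ω ^ 2 := by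
    ext ω
    simp only [hD, Pi.add_apply, Pi.smul_apply, Pi.mul_apply, Pi.sub_apply, smul_eq_mul]
    ring
  have h1 : μ[fun ω ↦ M i ω ^ 2 | 𝓕 i] = fun ω ↦ M i ω ^ 2 :=
    condExp_of_stronglyMeasurable (𝓕.le i) ((hM.stronglyAdapted i).pow 2) hMi2
  have hDcond : μ[D | 𝓕 i] =ᵐ[μ] 0 := by
    have h := condExp_sub (hM.integrable j) (hM.integrable i) (𝓕 i) (μ := μ)
    have h' : μ[M i | 𝓕 i] = M i :=
      condExp_of_stronglyMeasurable (𝓕.le i) (hM.stronglyAdapted i) (hM.integrable i)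
    filter_upwards [h, hM.condExp_ae_eq hij] with ω hω hω'
    rw [hD, hω, Pi.sub_apply, hω', h', sub_self, Pi.zero_apply]
  have h2 : μ[M i * D | 𝓕 i] =ᵐ[μ] 0 := by
    have := condExp_mul_of_stronglyMeasurable_left (hM.stronglyAdapted i) hMiD hDint (m := 𝓕 i)
    filter_upwards [this, hDcond] with ω hω hω'
    rw [hω, Pi.mul_apply, hω', Pi.zero_apply, mul_zero]
  have h3 : 0 ≤ᵐ[μ] μ[fun ω ↦ D ω ^ 2 | 𝓕 i] :=
    condExp_nonneg (ae_of_all _ fun ω ↦ sq_nonneg (D ω))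
  have hA := condExp_add hMi2 (hMiD.smul (2 : ℝ)) (𝓕 i) (μ := μ)
  have hB := condExp_add (hMi2.add (hMiD.smul (2 : ℝ))) hD2 (𝓕 i) (μ := μ)
  have hS := condExp_smul (2 : ℝ) (M i * D) (𝓕 i) (μ := μ)
  change (fun ω ↦ M i ω ^ 2) ≤ᵐ[μ] μ[fun ω ↦ M j ω ^ 2 | 𝓕 i]
  rw [hdec]
  filter_upwards [hA, hB, hS, h2, h3] with ω hAω hBω hSω h2ω h3ω
  simp only [Pi.add_apply, Pi.smul_apply, smul_eq_mul, Pi.zero_apply] at hAω hBω hSω h3ω ⊢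
  rw [hBω, hAω, hSω, h1, h2ω]
  simp only [Pi.zero_apply, mul_zero, add_zero]
  linarith

/-- A martingale read along a monotone sequence of times `τ : ℕ → ι` is a discrete-time
martingale for the filtration `k ↦ 𝓕 (τ k)`. Dot-notation extension declared in Mathlib's
namespace `MeasureTheory.Martingale`. [folklore] -/
theorem Martingale.reindex_nat (hM : Martingale M 𝓕 μ) {τ : ℕ → ι} (hτ : Monotone τ) :
    Martingale (fun k ↦ M (τ k))
      ⟨fun k ↦ 𝓕 (τ k), fun _ _ h ↦ 𝓕.mono (hτ h), fun k ↦ 𝓕.le (τ k)⟩ μ :=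
  ⟨fun k ↦ hM.stronglyAdapted (τ k), fun _ _ hkl ↦ hM.condExp_ae_eq (hτ hkl)⟩

end MeasureTheory

namespace Literature.Probability.Process

variable {Ω : Type*} {m : MeasurableSpace Ω} {μ : Measure Ω}

/-- **Doob's `L²` maximal inequality along a finite grid**: for a square-integrable martingale
`M` (any index preorder), a monotone sequence of times `τ` and `ε > 0`,
`ε² · μ {∃ k ≤ N, ε ≤ |M (τ k)|} ≤ E[M (τ N)²]` (Mathlib's discrete `maximal_ineq` applied to the
submartingale `M (τ ·)²`).
Revuz–Yor, *Continuous Martingales and Brownian Motion* (1999), Ch. II, Thm (1.7); Doob (1953).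
[folklore] -/
theorem doob_sq_maximal_ineq_grid {ι : Type*} [Preorder ι] {𝓕 : Filtration ι m}
    {M : ι → Ω → ℝ} [IsFiniteMeasure μ] (hM : Martingale M 𝓕 μ) (hL2 : ∀ i, MemLp (M i) 2 μ)
    {τ : ℕ → ι} (hτ : Monotone τ) {ε : ℝ} (hε : 0 < ε) (N : ℕ) :
    ENNReal.ofReal (ε ^ 2) * μ {ω | ∃ k ≤ N, ε ≤ |M (τ k) ω|} ≤
      ENNReal.ofReal (∫ ω, M (τ N) ω ^ 2 ∂μ) := by
  have hsub := (hM.reindex_nat hτ).submartingale_sq (fun k ↦ hL2 (τ k))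
  have hnn : 0 ≤ fun k ω ↦ M (τ k) ω ^ 2 := fun k ω ↦ sq_nonneg _
  have h := maximal_ineq hsub hnn (ε := (ε ^ 2).toNNReal) N
  have hcoe : (((ε ^ 2).toNNReal : ℝ≥0) : ℝ) = ε ^ 2 := Real.coe_toNNReal _ (sq_nonneg ε)
  simp only [hcoe] at h
  have hset : {ω | ∃ k ≤ N, ε ≤ |M (τ k) ω|} =
      {ω | ε ^ 2 ≤ (range (N + 1)).sup' nonempty_range_add_one fun k ↦ M (τ k) ω ^ 2} := by
    ext ω
    simp only [Set.mem_setOf_eq, Finset.le_sup'_iff, mem_range, Nat.lt_succ_iff]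
    constructor
    · rintro ⟨k, hk, hε'⟩
      refine ⟨k, hk, ?_⟩
      nlinarith [abs_nonneg (M (τ k) ω), sq_abs (M (τ k) ω)]
    · rintro ⟨k, hk, hε'⟩
      refine ⟨k, hk, ?_⟩
      by_contra hcon
      push Not at hcon
      nlinarith [abs_nonneg (M (τ k) ω), sq_abs (M (τ k) ω)]
  rw [hset, show ENNReal.ofReal (ε ^ 2) = (((ε ^ 2).toNNReal : ℝ≥0) : ℝ≥0∞) from rfl]
  refine h.trans (ENNReal.ofReal_le_ofReal ?_)
  exact setIntegral_le_integral (hL2 (τ N)).integrable_sq (ae_of_all _ fun ω ↦ sq_nonneg _)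

/-- The dyadic grid of `[0, t]`: `dyad t n k = t · (k ∧ 2ⁿ) / 2ⁿ`, a monotone sequence in `k`
ending at `t`. (Local notation realised as a term, not a definition.) [folklore] -/
private theorem dyad_aux (t : ℝ≥0) (n : ℕ) :
    Monotone (fun k : ℕ ↦ t * ((min k (2 ^ n) : ℕ) : ℝ≥0) / 2 ^ n) ∧
    (fun k : ℕ ↦ t * ((min k (2 ^ n) : ℕ) : ℝ≥0) / 2 ^ n) (2 ^ n) = t ∧
    ∀ k, (fun k : ℕ ↦ t * ((min k (2 ^ n) : ℕ) : ℝ≥0) / 2 ^ n) k ≤ t := by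
  have h2 : (0 : ℝ≥0) < 2 ^ n := pow_pos two_pos n
  refine ⟨fun k l hkl ↦ ?_, ?_, fun k ↦ ?_⟩
  · dsimp only
    gcongr
  · simp only [min_self, Nat.cast_pow, Nat.cast_ofNat]
    rw [mul_div_assoc, div_self h2.ne', mul_one]
  · dsimp only
    calc t * ((min k (2 ^ n) : ℕ) : ℝ≥0) / 2 ^ n ≤ t * ((2 ^ n : ℕ) : ℝ≥0) / 2 ^ n := by
          gcongr
          exact min_le_right _ _
      _ = t := by
          simp only [Nat.cast_pow, Nat.cast_ofNat]
          rw [mul_div_assoc, div_self h2.ne', mul_one]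

/-- **Doob's `L²` maximal inequality in continuous time** for square-integrable martingales with
a.s. continuous paths, indexed by `ℝ≥0`: for `ε > 0` and every `t`,
`μ {ω | ∃ s ≤ t, ε ≤ |M s ω|} ≤ E[M_t²] / ε²`.
Proof: the discrete inequality along the dyadic grids `t k / 2ⁿ` (`doob_sq_maximal_ineq_grid`),
whose exceedance events increase with `n` and, for every `ε' < ε`, eventually contain the event
`{∃ s ≤ t, ε ≤ |M s|}` on continuous paths; then `ε' ↑ ε`.
Revuz–Yor, *Continuous Martingales and Brownian Motion* (1999), Ch. II, Thm (1.7) (from the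
discrete case "by considering countable dense subsets"); Doob (1953). [folklore] -/
theorem doob_sq_maximal_ineq_of_continuous {𝓕 : Filtration ℝ≥0 m} {M : ℝ≥0 → Ω → ℝ}
    [IsFiniteMeasure μ] (hM : Martingale M 𝓕 μ) (hL2 : ∀ s, MemLp (M s) 2 μ)
    (hcont : ∀ᵐ ω ∂μ, Continuous (M · ω)) {ε : ℝ} (hε : 0 < ε) (t : ℝ≥0) :
    μ {ω | ∃ s ≤ t, ε ≤ |M s ω|} ≤ ENNReal.ofReal ((∫ ω, M t ω ^ 2 ∂μ) / ε ^ 2) := by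
  set C : ℝ := ∫ ω, M t ω ^ 2 ∂μ with hC
  have hC0 : 0 ≤ C := integral_nonneg fun ω ↦ sq_nonneg _
  -- the dyadic grids and their exceedance events
  let τ : ℕ → ℕ → ℝ≥0 := fun n k ↦ t * ((min k (2 ^ n) : ℕ) : ℝ≥0) / 2 ^ n
  let A : ℝ → ℕ → Set Ω := fun e n ↦ {ω | ∃ k ≤ 2 ^ n, e ≤ |M (τ n k) ω|}
  -- Step 1: the discrete bound on each grid
  have hgrid : ∀ {e : ℝ}, 0 < e → ∀ n, μ (A e n) ≤ ENNReal.ofReal (C / e ^ 2) := by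
    intro e he n
    obtain ⟨hmono, hlast, -⟩ := dyad_aux t n
    have h := doob_sq_maximal_ineq_grid hM hL2 hmono he (2 ^ n)
    have hlast' : M (τ n (2 ^ n)) = M t := by
      show M ((fun k : ℕ ↦ t * ((min k (2 ^ n) : ℕ) : ℝ≥0) / 2 ^ n) (2 ^ n)) = M t
      rw [hlast]
    rw [hlast'] at h
    have he2 : 0 < e ^ 2 := by positivity
    rw [ENNReal.ofReal_div_of_pos he2]
    refine (ENNReal.le_div_iff_mul_le (Or.inl ((ENNReal.ofReal_pos.2 he2).ne'))
      (Or.inl ENNReal.ofReal_ne_top)).2 ?_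
    rw [mul_comm]
    exact h
  -- Step 2: the grids refine: `A e n ⊆ A e (n + 1)`
  have hAmono : ∀ e, Monotone (A e) := by
    intro e
    refine monotone_nat_of_le_succ fun n ↦ ?_
    rintro ω ⟨k, hk, hek⟩
    refine ⟨2 * k, by rw [pow_succ]; omega, ?_⟩
    have : τ (n + 1) (2 * k) = τ n k := by
      show t * ((min (2 * k) (2 ^ (n + 1)) : ℕ) : ℝ≥0) / 2 ^ (n + 1) =
        t * ((min k (2 ^ n) : ℕ) : ℝ≥0) / 2 ^ n
      rw [min_eq_left hk, min_eq_left (by rw [pow_succ]; omega)]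
      push_cast
      rw [pow_succ]
      field_simp
    rw [this]
    exact hek
  -- Step 3: on continuous paths, `{∃ s ≤ t, ε ≤ |M s|} ⊆ ⋃ n, A e n` for every `e < ε`
  have hcover : ∀ {e : ℝ}, e < ε → ∀ ω, Continuous (M · ω) → (∃ s ≤ t, ε ≤ |M s ω|) →
      ω ∈ ⋃ n, A e n := by
    intro e heε ω hω ⟨s, hst, hεs⟩
    -- continuity of `|M · ω|` at `s`: near `s`, `|M| > e`
    have hcont' : Continuous fun r ↦ |M r ω| := continuous_abs.comp hω
    have hopen : IsOpen {r : ℝ≥0 | e < |M r ω|} := isOpen_lt continuous_const hcont'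
    have hs_mem : s ∈ {r : ℝ≥0 | e < |M r ω|} := heε.trans_le hεs
    obtain ⟨δ, hδ, hball⟩ := Metric.isOpen_iff.1 hopen s hs_mem
    -- a dyadic grid point of `[0, t]` within `δ` of `s`
    rcases eq_or_ne t 0 with ht0 | ht0
    · -- `t = 0`: then `s = 0` is the grid point `k = 0`
      refine Set.mem_iUnion.2 ⟨0, 0, Nat.zero_le _, ?_⟩
      have hs0 : s = 0 := nonpos_iff_eq_zero.1 (ht0 ▸ hst)
      have : τ 0 0 = s := by
        show t * ((min 0 (2 ^ 0) : ℕ) : ℝ≥0) / 2 ^ 0 = s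
        simp [hs0]
      rw [this]
      exact heε.le.trans hεs
    · -- `t > 0`: choose `n` with `t / 2ⁿ < δ` and `k = ⌊s 2ⁿ / t⌋`
      have ht0 : 0 < t := pos_iff_ne_zero.2 ht0
      obtain ⟨n, hn⟩ : ∃ n : ℕ, (t : ℝ) / 2 ^ n < δ := by
        obtain ⟨n, hn⟩ := exists_nat_gt ((t : ℝ) / δ)
        refine ⟨n, ?_⟩
        have h2n : (n : ℝ) < 2 ^ n := by exact_mod_cast Nat.lt_two_pow_self
        rw [div_lt_iff₀ (by positivity)]
        calc (t : ℝ) = (t : ℝ) / δ * δ := by field_simp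
          _ < n * δ := by gcongr
          _ < 2 ^ n * δ := by gcongr
          _ = δ * 2 ^ n := mul_comm _ _
      refine Set.mem_iUnion.2 ⟨n, ?_⟩
      have htpos : (0 : ℝ) < t := by exact_mod_cast ht0
      have h2pos : (0 : ℝ) < 2 ^ n := by positivity
      have hst' : (s : ℝ) ≤ t := by exact_mod_cast hst
      set k : ℕ := ⌊(s : ℝ) * 2 ^ n / t⌋₊ with hk
      have hx : (s : ℝ) * 2 ^ n / t ≤ (2 ^ n : ℕ) := by
        push_cast
        rw [div_le_iff₀ htpos]
        nlinarith
      have hk_le : k ≤ 2 ^ n := Nat.floor_le_of_le hx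
      refine ⟨k, hk_le, le_of_lt (hball ?_)⟩
      -- `dist (τ n k) s < δ`
      rw [Metric.mem_ball, NNReal.dist_eq]
      have hτ : ((τ n k : ℝ≥0) : ℝ) = (t : ℝ) * k / 2 ^ n := by
        show ((t * ((min k (2 ^ n) : ℕ) : ℝ≥0) / 2 ^ n : ℝ≥0) : ℝ) = (t : ℝ) * k / 2 ^ n
        rw [min_eq_left hk_le]
        push_cast
        ring
      rw [hτ]
      have hfl1 : (k : ℝ) ≤ (s : ℝ) * 2 ^ n / t := Nat.floor_le (by positivity)
      have hfl2 : (s : ℝ) * 2 ^ n / t < k + 1 := Nat.lt_floor_add_one _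
      have h1 : (t : ℝ) * k ≤ s * 2 ^ n := by
        have := (le_div_iff₀ htpos).1 hfl1
        linarith
      have h2 : (s : ℝ) * 2 ^ n < t * k + t := by
        have := (div_lt_iff₀ htpos).1 hfl2
        linarith
      rw [abs_sub_lt_iff]
      constructor
      · -- `t k / 2ⁿ - s ≤ 0 < δ`
        have : (t : ℝ) * k / 2 ^ n ≤ s := by
          rw [div_le_iff₀ h2pos]
          exact h1
        linarith
      · -- `s - t k / 2ⁿ < t / 2ⁿ < δ`
        have : (s : ℝ) - (t : ℝ) * k / 2 ^ n < (t : ℝ) / 2 ^ n := by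
          have e1 : (s : ℝ) < (t * k + t) / 2 ^ n := by
            rw [lt_div_iff₀ h2pos]
            exact h2
          have e2 : ((t : ℝ) * k + t) / 2 ^ n = (t : ℝ) * k / 2 ^ n + t / 2 ^ n := by ring
          linarith
        linarith
  -- Step 4: assemble, for each `e ∈ (0, ε)`
  have hbound : ∀ {e : ℝ}, 0 < e → e < ε →
      μ {ω | ∃ s ≤ t, ε ≤ |M s ω|} ≤ ENNReal.ofReal (C / e ^ 2) := by
    intro e he heε
    have hsub : {ω | ∃ s ≤ t, ε ≤ |M s ω|} ⊆ (⋃ n, A e n) ∪ {ω | ¬ Continuous (M · ω)} := by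
      intro ω hω
      by_cases hc : Continuous (M · ω)
      · exact Or.inl (hcover heε ω hc hω)
      · exact Or.inr hc
    have hnull : μ {ω | ¬ Continuous (M · ω)} = 0 := ae_iff.1 hcont
    calc μ {ω | ∃ s ≤ t, ε ≤ |M s ω|}
        ≤ μ ((⋃ n, A e n) ∪ {ω | ¬ Continuous (M · ω)}) := measure_mono hsub
      _ ≤ μ (⋃ n, A e n) + μ {ω | ¬ Continuous (M · ω)} := measure_union_le _ _
      _ = μ (⋃ n, A e n) := by rw [hnull, add_zero]
      _ ≤ ENNReal.ofReal (C / e ^ 2) := by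
          have hlim := tendsto_measure_iUnion_atTop (μ := μ) (hAmono e)
          exact le_of_tendsto' hlim fun n ↦ hgrid he n
  -- Step 5: let `e ↑ ε`
  have hlim : Tendsto (fun j : ℕ ↦ ENNReal.ofReal (C / (ε * (1 - 1 / ((j : ℝ) + 2))) ^ 2))
      atTop (𝓝 (ENNReal.ofReal (C / ε ^ 2))) := by
    refine ENNReal.tendsto_ofReal (Tendsto.div tendsto_const_nhds ?_ (by positivity))
    have h1 : Tendsto (fun j : ℕ ↦ 1 - 1 / ((j : ℝ) + 2)) atTop (𝓝 (1 - 0)) := by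
      refine tendsto_const_nhds.sub ?_
      have := tendsto_one_div_add_atTop_nhds_zero_nat (𝕜 := ℝ)
      refine (this.comp (tendsto_add_atTop_nat 1)).congr fun j ↦ ?_
      simp only [Function.comp_apply, Nat.cast_add, Nat.cast_one]
      ring
    have h2 : Tendsto (fun j : ℕ ↦ ε * (1 - 1 / ((j : ℝ) + 2))) atTop (𝓝 ε) := by
      simpa using tendsto_const_nhds.mul h1
    simpa using h2.pow 2
  refine ge_of_tendsto' hlim fun j ↦ hbound ?_ ?_
  · have : (0 : ℝ) < 1 - 1 / ((j : ℝ) + 2) := by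
      rw [sub_pos, div_lt_one (by positivity)]
      linarith [j.cast_nonneg (α := ℝ)]
    positivity
  · have : 1 - 1 / ((j : ℝ) + 2) < 1 := by
      rw [sub_lt_self_iff]
      positivity
    calc ε * (1 - 1 / ((j : ℝ) + 2)) < ε * 1 := by gcongr
      _ = ε := mul_one ε

end Literature.Probability.Process
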